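import Summits.ResolutionOfSingularities.ResolutionOfSingularities.Theorems.WeightedInvariantWeightedConstructionPlexComapStalk
import Summits.ResolutionOfSingularities.ResolutionOfSingularities.Theorems.WeightedInvariantWeightedConstructionPlexComapResidueField
import Summits.ResolutionOfSingularities.ResolutionOfSingularities.Theorems.WeightedInvariantHypersurfaceCentreAlgebraize
import Summits.ResolutionOfSingularities.ResolutionOfSingularities.Theorems.WeightedInvariantWeightedConstructionWeightedChartBasicOpen
import Literature.AlgebraicGeometry.Resolution.MarkedIdealsLemmas
import Mathlib.AlgebraicGeometry.Morphisms.Finite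
import HarnessLib

/-!
# (P-a) Smooth pull-back of a weighted chart

Route `ResolutionOfSingularities/WeightedInvariant`, door `Theses.WeightedInvariant.HypersurfaceCentreConstruction`
(stmt-ResolutionOfSingularities-19897), e-ladder `e = 1` (res-D-pv-025 AS res-L1-w43-stub-10, PIECES ON OFFER 2026-08-27T06:29:57Z,
piece (P-a); consumers: L3 «`act^* J = pr^* J` of the `e = 1` centre on `T′ × W`» and T-e1-L0 «orbit extension by descent along
`act : T × U → act(T × U)`»). [OURS · L1 W4.3] Def-free helper, `--supports stmt-ResolutionOfSingularities-19897 --as helper`; nothing here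
is a claim about Hironaka's problem; AI-written, weaker than expert review.

**Statement.** `k` a perfect field, `f : Y ⟶ Spec k` and `g : Y₁ ⟶ Y` SMOOTH, `R` a Rees algebra on `Y` with a weighted chart
`(U, u, w)` (Włodarczyk 2.1.10: `Rₙ(U) = (u^α : Σ wᵢαᵢ ≥ n)`, the `uᵢ` part of a regular system of parameters at every point of
`V(u) ∩ U`), `R₁` the pulled-back Rees algebra on `Y₁` (`R₁.piece n = (R.piece n).comap g` for all `n` — supplied by the
consumer; no `ReesAlgebraData.comap` is introduced), and `U₁ ⊆ g⁻¹U` an affine open of `Y₁`: then `(U₁, g^* u, w)` is a weighted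
chart of `R₁` (`ReesAlgebraData.IsWeightedChart.of_comap_of_smooth`).

**Proof.** Pieces: `((R.piece n).comap g)(U₁) = Rₙ(U)·Γ(Y₁,U₁)` (`ideal_comap_of_le`, GW I Ex. 4.36) and
`(u^α)·Γ(Y₁,U₁) = ((g^*u)^α)` (`weightedMonomialIdeal_map`). Cotangent independence at a point `y₁ ∈ V(g^*u) ∩ U₁`: choose a
CLOSED point `y′` of `Y₁` in `closure {y₁} ∩ U₁` (`Y₁` is Jacobson, Mathlib `nonempty_inter_closedPoints`); `g y′` is closed in `Y`
(Stacks 01TB, Mathlib `Scheme.Hom.closePoints_subset_preimage_closedPoints`), so `κ(g y′)` is formally smooth over the perfect `k`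
(`formallySmooth_residueField_stalk_of_isClosed`); independence at `g y′` (the chart) ascends to `y′` along the smooth `g`
(`linearIndependent_toCotangent_stalkMap_of_smooth`), spreads to an affine neighbourhood of `y′` (`exists_affineOpens_forall_linearIndependent_toCotangent`,
`Literature/…/CotangentIndependenceSpread`), and that neighbourhood contains the generization `y₁`.
-/

noncomputable section

set_option linter.dupNamespace false -- mandated namespace of this single-conjunct summit

open CategoryTheory CategoryTheory.Limits AlgebraicGeometry TopologicalSpace IsLocalRing
open Literature.AlgebraicGeometry.Resolution

namespace Summit.ResolutionOfSingularities.ResolutionOfSingularities.Theorems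

/-- Germs of pulled-back sections are the images of the germs under the stalk map (`g^*` then germ at `y₁` = germ at `g y₁`
then `g^#_{y₁}`). [folklore] -/
theorem germ_appLE_eq_stalkMap_germ {Y Y₁ : Scheme.{0}} (g : Y₁ ⟶ Y) (U : Y.affineOpens) (U₁ : Y₁.affineOpens)
    (hU₁ : (U₁ : Y₁.Opens) ≤ g ⁻¹ᵁ (U : Y.Opens)) {y₁ : Y₁} (hy₁ : y₁ ∈ (U₁ : Y₁.Opens)) (s : Γ(Y, U)) :
    (Y₁.presheaf.germ (U₁ : Y₁.Opens) y₁ hy₁).hom ((g.appLE U U₁ hU₁).hom s) =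
      (g.stalkMap y₁).hom ((Y.presheaf.germ (U : Y.Opens) (g y₁) (hU₁ hy₁)).hom s) := by
  have heq : g.appLE U U₁ hU₁ ≫ Y₁.presheaf.germ (U₁ : Y₁.Opens) y₁ hy₁ =
      Y.presheaf.germ (U : Y.Opens) (g y₁) (hU₁ hy₁) ≫ g.stalkMap y₁ := by
    rw [Scheme.Hom.germ_stalkMap, Scheme.Hom.appLE, Category.assoc, TopCat.Presheaf.germ_res]
  have := congrArg (fun φ => φ.hom s) heq
  simpa only [CommRingCat.hom_comp, RingHom.comp_apply] using this

/-- A germ in the maximal ideal downstairs iff its image under the (local) stalk map is in the maximal ideal upstairs.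
[folklore] -/
theorem germ_mem_maximalIdeal_of_stalkMap_mem {Y Y₁ : Scheme.{0}} (g : Y₁ ⟶ Y) (y₁ : Y₁)
    {a : Y.presheaf.stalk (g y₁)} (ha : (g.stalkMap y₁).hom a ∈ maximalIdeal (Y₁.presheaf.stalk y₁)) :
    a ∈ maximalIdeal (Y.presheaf.stalk (g y₁)) := by
  rw [IsLocalRing.mem_maximalIdeal, mem_nonunits_iff] at ha ⊢
  exact fun hu => ha (hu.map _)

/-- If a section's germ at `y₁` is not a unit and `y₁ ⤳ y′` inside the open, the germ at `y′` is not a unit either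
(`D(s)` is open). [folklore] -/
theorem germ_mem_maximalIdeal_of_specializes {Y₁ : Scheme.{0}} (U₁ : Y₁.Opens) {y₁ y' : Y₁} (h : y₁ ⤳ y')
    (hy₁ : y₁ ∈ U₁) (hy' : y' ∈ U₁) (s : Γ(Y₁, U₁))
    (hs : (Y₁.presheaf.germ U₁ y₁ hy₁).hom s ∈ maximalIdeal (Y₁.presheaf.stalk y₁)) :
    (Y₁.presheaf.germ U₁ y' hy').hom s ∈ maximalIdeal (Y₁.presheaf.stalk y') := by
  rw [IsLocalRing.mem_maximalIdeal, mem_nonunits_iff] at hs ⊢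
  intro hu
  have hy'D : y' ∈ Y₁.basicOpen s := (Y₁.mem_basicOpen s y' hy').mpr hu
  have hy₁D : y₁ ∈ Y₁.basicOpen s := h.mem_open (Y₁.basicOpen s).isOpen hy'D
  exact hs ((Y₁.mem_basicOpen s y₁ hy₁).mp hy₁D)

/-- **(P-a) Smooth pull-back of a weighted chart.** `k` perfect, `f : Y → Spec k` and `g : Y₁ → Y` smooth; `R₁` the pull-back of
the Rees algebra `R` (`R₁.piece n = (R.piece n).comap g`); `(U, u, w)` a weighted chart of `R`; `U₁ ⊆ g⁻¹U` affine. Then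
`(U₁, g^*u, w)` is a weighted chart of `R₁`. [cite: Wlodarczyk2022, 2.1.10 and Lemma 2.1.12] -/
theorem ReesAlgebraData.IsWeightedChart.of_comap_of_smooth {k : Type} [Field k] [PerfectField k] {Y Y₁ : Scheme.{0}}
    (f : Y ⟶ Spec (.of k)) [Smooth f] (g : Y₁ ⟶ Y) [Smooth g] {R : ReesAlgebraData Y} {R₁ : ReesAlgebraData Y₁}
    (hR₁ : ∀ n, R₁.piece n = (R.piece n).comap g) {U : Y.affineOpens} {m : ℕ} {u : Fin m → Γ(Y, U)} {w : Fin m → ℕ}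
    (h : R.IsWeightedChart U u w) (U₁ : Y₁.affineOpens) (hU₁ : (U₁ : Y₁.Opens) ≤ g ⁻¹ᵁ (U : Y.Opens)) :
    R₁.IsWeightedChart U₁ (fun i => (g.appLE U U₁ hU₁).hom (u i)) w := by
  haveI : JacobsonSpace Y := LocallyOfFiniteType.jacobsonSpace f
  haveI : JacobsonSpace Y₁ := LocallyOfFiniteType.jacobsonSpace (g ≫ f)
  refine ⟨h.w_pos, fun n => ?_, fun y₁ hy₁ hvan => ?_⟩
  · -- the pieces
    rw [hR₁ n, ideal_comap_of_le g (R.piece n) U U₁ hU₁, h.ideal_eq n, weightedMonomialIdeal_map]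
  · -- cotangent independence at an arbitrary point `y₁ ∈ V(g^*u) ∩ U₁`
    -- Step A: a closed point `y'` of `Y₁` with `y₁ ⤳ y'`, inside `U₁`
    obtain ⟨y', ⟨hy'cl₁, hy'U₁⟩, hy'cl⟩ := nonempty_inter_closedPoints (X := Y₁)
      (Z := closure {y₁} ∩ (U₁ : Set Y₁)) ⟨y₁, subset_closure rfl, hy₁⟩
      (isClosed_closure.isLocallyClosed.inter (U₁ : Y₁.Opens).isOpen.isLocallyClosed)
    rw [mem_closedPoints_iff] at hy'cl
    have hspec : y₁ ⤳ y' := specializes_iff_mem_closure.mpr hy'cl₁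
    have hy'U₁' : y' ∈ (U₁ : Y₁.Opens) := hy'U₁
    -- Step B: the pulled-back parameters vanish at `y'`
    have hvan' : ∀ i, (Y₁.presheaf.germ (U₁ : Y₁.Opens) y' hy'U₁').hom ((g.appLE U U₁ hU₁).hom (u i)) ∈
        maximalIdeal (Y₁.presheaf.stalk y') :=
      fun i => germ_mem_maximalIdeal_of_specializes (U₁ : Y₁.Opens) hspec hy₁ hy'U₁' _ (hvan i)
    -- the parameters `u` vanish at `g y'`
    have hmax : ∀ i, (Y.presheaf.germ (U : Y.Opens) (g y') (hU₁ hy'U₁')).hom (u i) ∈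
        maximalIdeal (Y.presheaf.stalk (g y')) := by
      intro i
      apply germ_mem_maximalIdeal_of_stalkMap_mem g y'
      rw [← germ_appLE_eq_stalkMap_germ g U U₁ hU₁ hy'U₁']
      exact hvan' i
    -- Step C: `g y'` is closed in `Y`, so `κ(g y')` is formally smooth over the perfect `k`
    have hgy'cl : IsClosed ({g y'} : Set Y) := by
      have := g.closePoints_subset_preimage_closedPoints (mem_closedPoints_iff.mpr hy'cl)
      exact mem_closedPoints_iff.mp this
    have hκ := formallySmooth_residueField_stalk_of_isClosed f (g y') hgy'cl
    -- Step D: independence at `g y'` (the chart) ascends to `y'` along the smooth `g`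
    have hli := h.linearIndependent (g y') (hU₁ hy'U₁') hmax
    have hli' := linearIndependent_toCotangent_stalkMap_of_smooth f g y' hκ
      (fun i => (Y.presheaf.germ (U : Y.Opens) (g y') (hU₁ hy'U₁')).hom (u i)) hmax hli
    have hfam : (fun i => (maximalIdeal (Y₁.presheaf.stalk y')).toCotangent
        ⟨(g.stalkMap y').hom ((Y.presheaf.germ (U : Y.Opens) (g y') (hU₁ hy'U₁')).hom (u i)),
          map_nonunit (g.stalkMap y').hom _ (hmax i)⟩) =
        fun i => (maximalIdeal (Y₁.presheaf.stalk y')).toCotangent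
          ⟨(Y₁.presheaf.germ (U₁ : Y₁.Opens) y' hy'U₁').hom ((g.appLE U U₁ hU₁).hom (u i)), hvan' i⟩ := by
      funext i
      congr 1
      exact Subtype.ext (germ_appLE_eq_stalkMap_germ g U U₁ hU₁ hy'U₁' (u i)).symm
    rw [hfam] at hli'
    -- Step E: spread to an affine neighbourhood of `y'`, which contains the generization `y₁`
    haveI : IsRegularLocalRing (Y₁.presheaf.stalk y') := isRegularLocalRing_stalk_of_smooth_of_field (g ≫ f) y'
    obtain ⟨V, hVU₁, hy'V, hspread⟩ := exists_affineOpens_forall_linearIndependent_toCotangent (g ≫ f) U₁ hy'U₁'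
      (fun i => (g.appLE U U₁ hU₁).hom (u i)) hvan' hli'
    have hy₁V : y₁ ∈ (V : Y₁.Opens) := hspec.mem_open (V : Y₁.Opens).isOpen hy'V
    have hres : ∀ i, (Y₁.presheaf.germ (V : Y₁.Opens) y₁ hy₁V).hom
        ((Y₁.presheaf.map (homOfLE hVU₁).op).hom ((g.appLE U U₁ hU₁).hom (u i))) =
        (Y₁.presheaf.germ (U₁ : Y₁.Opens) y₁ hy₁).hom ((g.appLE U U₁ hU₁).hom (u i)) :=
      fun i => TopCat.Presheaf.germ_res_apply Y₁.presheaf (homOfLE hVU₁) y₁ hy₁V _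
    have hvanV : ∀ i, (Y₁.presheaf.germ (V : Y₁.Opens) y₁ hy₁V).hom
        ((Y₁.presheaf.map (homOfLE hVU₁).op).hom ((g.appLE U U₁ hU₁).hom (u i))) ∈
        maximalIdeal (Y₁.presheaf.stalk y₁) := fun i => by rw [hres i]; exact hvan i
    have hliV := (hspread y₁ hy₁V hvanV).2
    have hfamV : (fun i => (maximalIdeal (Y₁.presheaf.stalk y₁)).toCotangent
        ⟨(Y₁.presheaf.germ (V : Y₁.Opens) y₁ hy₁V).hom
          ((Y₁.presheaf.map (homOfLE hVU₁).op).hom ((g.appLE U U₁ hU₁).hom (u i))), hvanV i⟩) =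
        fun i => (maximalIdeal (Y₁.presheaf.stalk y₁)).toCotangent
          ⟨(Y₁.presheaf.germ (U₁ : Y₁.Opens) y₁ hy₁).hom ((g.appLE U U₁ hU₁).hom (u i)), hvan i⟩ := by
      funext i
      congr 1
      exact Subtype.ext (hres i)
    rw [hfamV] at hliV
    exact hliV

/-- **Regular weighted centres pull back along smooth morphisms.** `k` perfect, `f : Y → Spec k` and `g : Y₁ → Y` smooth,
`R₁` the pull-back of the Rees algebra `R` (`R₁.piece n = (R.piece n).comap g`): if `R` is a regular weighted centre on `Y`
(Włodarczyk 2.1.10: locally a weighted chart) then so is `R₁` on `Y₁` — every point `y₁` has an affine neighbourhood inside the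
preimage of a chart of `g y₁`, on which `(P-a)` applies. [cite: Wlodarczyk2022, 2.1.10] -/
theorem ReesAlgebraData.IsRegularWeightedCentre.of_comap_of_smooth {k : Type} [Field k] [PerfectField k]
    {Y Y₁ : Scheme.{0}} (f : Y ⟶ Spec (.of k)) [Smooth f] (g : Y₁ ⟶ Y) [Smooth g] {R : ReesAlgebraData Y}
    {R₁ : ReesAlgebraData Y₁} (hR₁ : ∀ n, R₁.piece n = (R.piece n).comap g) (h : R.IsRegularWeightedCentre) :
    R₁.IsRegularWeightedCentre := by
  intro y₁
  obtain ⟨U, hyU, m, u, w, hchart⟩ := h (g y₁)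
  -- an affine open `U₁ ∋ y₁` inside `g⁻¹ U`
  obtain ⟨_, ⟨U₁, hU₁, rfl⟩, hy₁, hU₁le⟩ := Y₁.isBasis_affineOpens.exists_subset_of_mem_open
    (show y₁ ∈ ((g ⁻¹ᵁ (U : Y.Opens) : Y₁.Opens) : Set Y₁) from hyU) (g ⁻¹ᵁ (U : Y.Opens)).isOpen
  exact ⟨⟨U₁, hU₁⟩, hy₁, m, _, w,
    ReesAlgebraData.IsWeightedChart.of_comap_of_smooth f g hR₁ hchart ⟨U₁, hU₁⟩ hU₁le⟩

end Summit.ResolutionOfSingularities.ResolutionOfSingularities.Theorems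

end
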